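import Summits.QuantumFields.BalabanUV.Beta.GAN24.W3TowerOfZSRoot
import Summits.QuantumFields.BalabanUV.Beta.GAN24.WSlotSourceZeroModeHolds
import Summits.QuantumFields.BalabanUV.Beta.GAN24.WSlotMixedShape
import Summits.QuantumFields.BalabanUV.Beta.GAN24.StencilSlotWallThree

/-!
# `BalabanUV.Beta.GAN24.WSlotT2TablesAn1` — binder row G-an2-4 / (CONV-C), W-slot road «W3»: **END #4 — THE W-PAIR AND THE CLOSING SENTENCE FOR THE β-LEAD's
# WALL FAMILY LITERAL `MixedJetTablesPlug.JsBalAn1` / `JsBalAn1Ctr` (an1's ROOTED border `vh₂SAt (toSite r) Lc` AND mixed table `mixFFAt (toSite r) Lc`, every box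
# root `r`, in particular the CENTRED root `ctrOff`), AT THE EXACT PIN `cE₂ := +Lc^(2(3+1))`, `d = 3`, `Lc ≥ 2` — referee r53 (w9) ROOT ALIGNMENT MET AT END LEVEL**
# (row owner b2b-balaban-gan24-p1, gen 6; row (B) of `HOME/b2b-balaban-gan24-p1/SLOT-COVERAGE.md`; road BF-x's family `D1BFx/FirstStepLargeBlock`)

NOT IN PRINT; OUR PROOF ATTEMPT.  HONEST FRAMING (cell contract, verbatim): «discharging `BetaPertH` makes Bałaban's UV stability UNCONDITIONAL — a real constructive-QFT
result; it is NOT the continuum limit and NOT the Clay problem.»  HONEST DEPENDENCY (verbatim): «continuum YM on T⁴ ⇐ BetaPertH ∧ nine spine estimates (0/9 proved);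
BetaPertH ⇐ (D1) ∧ (D4) ∧ CAP+tail; G-an2-4 gates asym, D1 and NE2/3/4.»

WHAT.  `WSlotT2Tables` (END #3, p217017) gave the wall's W-pair and the closing sentence for an2's Stage-B family at the EXACT pin with an1's mixed table
`mixFFAt (toSite r) Lc` but the BASE border `vh₂S 3 Lc = vh₂SAt 0 Lc`.  Referee r53 (w9): an1's plug of record on the D1 side and the β-lead's literal used by road
BF-x (`MixedJetTablesPlug.JsBalAn1Ctr`) take the border at the SAME root as the mixed table.  The W3 chain was re-run at the rooted border by this lineage (gen 6:
`WSlotFirstDiffBorder`, `TransportRowsRoot`, `W3SourceRowsEndRoot`, `T2ShapeThreeOfF2aRoot`, `WSlotForcingZeroModeRoot`, `WSlotForcingZeroModeW3Root`, `W3ForcingSymZRoot`,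
`W3ForcingOfZSRoot`, `ChargeStepSymRoot`, `FirstDiffSymChargeRoot`, `W3DriftOfZSRoot`, `W3TowerOfZSRoot` — decl-by-decl twins of the swarm's modules, proofs verbatim,
border lemmas an1's rooted ones); ROW W3-F2a at any border root is leaf-20's `WSlotSourceZeroModeHolds.zfree_bracket_an1` (p215354).  THIS module is the rooted
twin of leaf-08's `W3PinCountdown` and of the owner's `WSlotT2Tables` §2–§4:
* §1 `t2ShapeDrift_three_an1At_of_pinEq` — «T2Shape» ∧ «T2Drift» for `T2Of 3 Lc cE cVH cΛ cE₂ cB Tc (vh₂SAt (toSite r) Lc) (mixFFAt (toSite r) Lc)` from the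
  exact pin ALONE; `hW_hWall_three_an1At_of_pinEq` — the D1 wall's W-pair from the exact pin ALONE (leaf-11's socket `WSlotMixedShape.hW_hWall_three_an1_of_T2ShapeDrift`).
* §2 **`hW_hWall_three_an1At_pinned`** — the W-pair for the PINNED member `cE₂ := (Lc:ℝ)^(2*(3+1))`, NO hypothesis beyond `2 ≤ Lc`, `r ∈ box (3+1) Lc`.
* §4 **`allScalesSeq_secondMoment_JsBalAn1(Ctr)_pinned`** — road BF-x's `hall`/`hθ0`/`hθ1` binders (`D1BFx/RoadEnd.d1Drift_of_meanRoad`) for its own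
  literal, NO hypothesis: `∃ κ θ, 0 ≤ θ < 1 ∧ AllScalesSeq (j ↦ secondMoment (TbalOf Lc (JsBalAn1Ctr …) j) μ ν) κ θ`.
* §3 **`d1Drift_iff_three_an1At_pinned`** / **`d1Drift_iff_three_JsBalAn1_pinned`** — THE CLOSING SENTENCE for `JsBalAn1 hLc hr cE cVH cΛ (Lc^8) cB Tc`: the D1 wall
  ⟺ the identification, NO analytic hypothesis (K-slot `KSlotAssembly`, S-slot road S3's twelve rows — border-free —, W-slot §2, through the owner's generic-`W` wall
  form `StencilSlotWallThree.d1Drift_JsBalOf_iff_three_of_wRows` p209916); **`d1Drift_iff_three_JsBalAn1Ctr_pinned`** — the same at the CENTRED root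
  (`JsBalAn1Ctr`, `AveragingContoursRooted.ctrOff_mem_box`): road BF-x's literal.
HONEST: [folklore] compositions; the (P6) decision that the `BetaPertH` wall literal IS this (or any) pinned member is an2's / the leads' and is NOT made here; the PIN
is root-independent (the charge identities and F2a's cell zero modes hold at every box root) and remains LOAD-BEARING at an3's `w22` (`ChargeStepSymD1.hZ1_iff_pinEq_w22`);
the recursive literal v2.26 and the fully rooted / native families are NOT served by this (rows (C)–(E) of the memo); NOT «W-slot closed» for the literal, NEVER
«G-an2-4 closed» as (CONV-C) for `G_k/H_k`; NOT BetaPertH, NOT continuum, NOT Clay.  0 `def`, 0 cite, 0 `def … : Prop`, 0 sorry.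
-/

noncomputable section

open Finset
open scoped BigOperators
open Literature.MathematicalPhysics.QuantumFieldTheory
open Literature.MathematicalPhysics.QuantumFieldTheory.Balaban1983to89
open Literature.MathematicalPhysics.QuantumFieldTheory.Balaban1983to89.Beta
open AffineAveraging (box toSite)
open AveragingContoursRooted (ctrOff ctrOff_mem_box)
open ExpKernelCalculus (MKer VertexFamily₂ hessKer shiftK)
open OneStepResolventKernel (Fib LocStencil)
open OneStepKernelFamily (KInvStep D1Drift TbalOf)
open RemainderConstAllScales (AllScalesSeq)
open AxialDressing (axDressK axVertexOfK)
open StepJetData (mfNeg)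
open SecondOrderResponse (W2SymOfK LocStencilFM)
open BalabanCompositeJets (LocStencil₂)
open BalabanStepJetsSucc (JsBal0Of JsBalOf mmRead)
open BalabanStepW2 (K3OfK Spure M1 M2Of WbalOf T2Of T2Of_loc CwOf δwOf δwOf_pos WbalOf_loc₂ JsBalT2Of)
open AveragingMixedJetTables (vh₂SAt mixFFAt)
open HessKerDressedLimit (limMKerOf limStOf limTabOf)
open Summit.QuantumFields.BalabanUV.Beta.HessKerDressedUnits (unitK unitS unitW)
open Summit.QuantumFields.BalabanUV.Beta.SecondOrderUnits (unitM unitS₂ unitM₂)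
open Summit.QuantumFields.BalabanUV.Beta.MixedJetTablesPlug (hmix_an1 hB_an1 JsBalAn1 JsBalAn1Ctr)
open Summit.QuantumFields.BalabanUV.Beta.GAN24.CombesThomas (sfStep smStep sfStep_ne_zero smStep_ne_zero)
open Summit.QuantumFields.BalabanUV.Beta.GAN24.KSlotAssembly (convCKWall_holds)
open Summit.QuantumFields.BalabanUV.Beta.GAN24.StencilSlotSAllThree (hS_hSall_three)
open Summit.QuantumFields.BalabanUV.Beta.HessKerConvCKPlug (exists_merged_rows)
open Summit.QuantumFields.BalabanUV.Beta.HessKerDressedUnitsWall (allScalesSeq_secondMoment_TbalOf_JsBalOf_unit)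
open Summit.QuantumFields.BalabanUV.Beta.GAN24.StencilSlotOfE3 (one_le_of_two_le)
open Summit.QuantumFields.BalabanUV.Beta.GAN24.BiStencilZeroMode (zmode)
open Summit.QuantumFields.BalabanUV.Beta.GAN24.T2RecursionAffine (lin4)
open Summit.QuantumFields.BalabanUV.Beta.GAN24.WSlotSourceZeroModeHolds (zfree_bracket_an1)
open Summit.QuantumFields.BalabanUV.Beta.GAN24.W3TowerOfZSRoot (t2ShapeDrift_three_an1_of_F2acell_pinEq)
open Summit.QuantumFields.BalabanUV.Beta.GAN24.WSlotMixedShape (hW_hWall_three_an1_of_T2ShapeDrift)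
open Summit.QuantumFields.BalabanUV.Beta.GAN24.StencilSlotWallThree (d1Drift_JsBalOf_iff_three_of_wRows)

namespace Summit.QuantumFields.BalabanUV.Beta.GAN24.WSlotT2TablesAn1

variable {Lc : ℕ} [NeZero Lc] {r : Fin (3 + 1) → ℕ}

/-! ## §1 The countdown at the rooted border: «T2Shape» ∧ «T2Drift» and the W-pair from the exact pin alone -/

/-- **«T2Shape» ∧ «T2Drift» AT an1's ROOTED TABLES FROM THE EXACT PIN ALONE** ((R3′) currency) [folklore composition: `W3TowerOfZSRoot.t2ShapeDrift_three_an1_of_F2acell_pinEq`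
with ROW W3-F2a := leaf-20's `WSlotSourceZeroModeHolds.zfree_bracket_an1 … (toSite r) … |>.2`]: `d = 3`, `2 ≤ Lc`, `r ∈ box (3+1) Lc`, `cE₂ = +Lc^{2(3+1)}`. -/
theorem t2ShapeDrift_three_an1At_of_pinEq (hLc : 2 ≤ Lc) (hr : r ∈ box (3 + 1) Lc) (cE cVH cΛ cE₂ cB : ℝ)
    (Tc : Fin 4 → Fin 4 → Fin 4 → Fin 4 → ℝ) (hpinEq : cE₂ = (Lc : ℝ) ^ (2 * (3 + 1))) :
    (∃ C₂ δ₂ : ℝ, 0 < δ₂ ∧ ∀ j, LocStencil₂ (unitS₂ (sfStep Lc j) (smStep 3 Lc j) (T2Of 3 Lc cE cVH cΛ cE₂ cB Tc (vh₂SAt (toSite r) Lc) (mixFFAt (toSite r) Lc) j)) C₂ δ₂) ∧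
    (∃ c ϑ δT : ℝ, 0 ≤ c ∧ 0 < ϑ ∧ ϑ < 1 ∧ 0 < δT ∧
      (∀ n, LocStencil₂ (fun κ u κ' u' => unitS₂ (sfStep Lc (n + 1)) (smStep 3 Lc (n + 1)) (T2Of 3 Lc cE cVH cΛ cE₂ cB Tc (vh₂SAt (toSite r) Lc) (mixFFAt (toSite r) Lc) (n + 1)) κ u κ' u' - unitS₂ (sfStep Lc n) (smStep 3 Lc n) (T2Of 3 Lc cE cVH cΛ cE₂ cB Tc (vh₂SAt (toSite r) Lc) (mixFFAt (toSite r) Lc) n) κ u κ' u') (c * ϑ ^ n) δT) ∧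
      (∀ k j, LocStencil₂ (fun κ u κ' u' => unitS₂ (sfStep Lc (k + j)) (smStep 3 Lc (k + j)) (T2Of 3 Lc cE cVH cΛ cE₂ cB Tc (vh₂SAt (toSite r) Lc) (mixFFAt (toSite r) Lc) (k + j)) κ u κ' u' - unitS₂ (sfStep Lc k) (smStep 3 Lc k) (T2Of 3 Lc cE cVH cΛ cE₂ cB Tc (vh₂SAt (toSite r) Lc) (mixFFAt (toSite r) Lc) k) κ u κ' u') (c * (1 - ϑ)⁻¹ * ϑ ^ k) δT) ∧
      (∀ n κ u κ' u' x z a b, |unitS₂ (sfStep Lc (n + 1)) (smStep 3 Lc (n + 1)) (T2Of 3 Lc cE cVH cΛ cE₂ cB Tc (vh₂SAt (toSite r) Lc) (mixFFAt (toSite r) Lc) (n + 1)) κ u κ' u' x z a b - unitS₂ (sfStep Lc n) (smStep 3 Lc n) (T2Of 3 Lc cE cVH cΛ cE₂ cB Tc (vh₂SAt (toSite r) Lc) (mixFFAt (toSite r) Lc) n) κ u κ' u' x z a b| ≤ c * ϑ ^ n)) :=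
  t2ShapeDrift_three_an1_of_F2acell_pinEq hLc hr cE cVH cΛ cE₂ cB Tc hpinEq
    (fun m => (zfree_bracket_an1 (d := 3) (one_le_of_two_le hLc) hr (toSite r) cE cVH cΛ cE₂ cB m).2)

/-- **THE D1 WALL's W-PAIR AT an1's ROOTED TABLES FROM THE EXACT PIN ALONE** [folklore composition: §1 ⨾ leaf-11's `WSlotMixedShape.hW_hWall_three_an1_of_T2ShapeDrift`, rates merged at
`min δ₂ δT` by `LocStencil₂.mono`].  The pin is the ONE hypothesis; NOT «W-slot closed». -/
theorem hW_hWall_three_an1At_of_pinEq (hLc : 2 ≤ Lc) (hr : r ∈ box (3 + 1) Lc) (cE cVH cΛ cE₂ cB : ℝ)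
    (Tc : Fin 4 → Fin 4 → Fin 4 → Fin 4 → ℝ) (hpinEq : cE₂ = (Lc : ℝ) ^ (2 * (3 + 1))) :
    ∃ Cw cW θW δW : ℝ, 0 ≤ θW ∧ θW < 1 ∧ 0 < δW ∧
      (∀ j, VertexFamily₂ (unitW (sfStep Lc j) (smStep 3 Lc j)
        (WbalOf 3 Lc cE cVH cΛ (T2Of 3 Lc cE cVH cΛ cE₂ cB Tc (vh₂SAt (toSite r) Lc) (mixFFAt (toSite r) Lc)) (mixFFAt (toSite r) Lc) j)) Lc Cw δW) ∧
      (∀ k j, VertexFamily₂ (unitW (sfStep Lc (k + j)) (smStep 3 Lc (k + j))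
        (WbalOf 3 Lc cE cVH cΛ (T2Of 3 Lc cE cVH cΛ cE₂ cB Tc (vh₂SAt (toSite r) Lc) (mixFFAt (toSite r) Lc)) (mixFFAt (toSite r) Lc) (k + j)) -
        unitW (sfStep Lc k) (smStep 3 Lc k)
        (WbalOf 3 Lc cE cVH cΛ (T2Of 3 Lc cE cVH cΛ cE₂ cB Tc (vh₂SAt (toSite r) Lc) (mixFFAt (toSite r) Lc)) (mixFFAt (toSite r) Lc) k)) Lc (cW * θW ^ k) δW) := by
  obtain ⟨⟨C₂, δ₂, hδ₂, hx⟩, c, ϑ, δT, -, hϑ0, hϑ1, hδT, -, hCau, -⟩ :=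
    t2ShapeDrift_three_an1At_of_pinEq hLc hr cE cVH cΛ cE₂ cB Tc hpinEq
  exact hW_hWall_three_an1_of_T2ShapeDrift hLc hr cE cVH cΛ
    (T₂ := T2Of 3 Lc cE cVH cΛ cE₂ cB Tc (vh₂SAt (toSite r) Lc) (mixFFAt (toSite r) Lc)) (δ₂ := min δ₂ δT)
    (fun j => (hx j).mono (min_le_left _ _))
    (fun k j => ((hCau k j).mono (min_le_right _ _)))
    (lt_min hδ₂ hδT) hϑ0.le hϑ1

/-! ## §2 The W-pair for the PINNED member at an1's rooted tables — no hypothesis -/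

/-- **THE WALL's W-PAIR FOR THE PINNED STAGE-B FAMILY AT an1's ROOTED TABLES, UNCONDITIONALLY** (`d = 3`, `2 ≤ Lc`, `r ∈ box (3+1) Lc`): `cE₂ := (Lc:ℝ)^(2*(3+1))`,
border `vh₂SAt (toSite r) Lc`, mixed table `mixFFAt (toSite r) Lc` — §1 at `hpinEq := rfl`.  (P6) is NOT decided here. -/
theorem hW_hWall_three_an1At_pinned (hLc : 2 ≤ Lc) (hr : r ∈ box (3 + 1) Lc) (cE cVH cΛ cB : ℝ) (Tc : Fin 4 → Fin 4 → Fin 4 → Fin 4 → ℝ) :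
    ∃ Cw cW θW δW : ℝ, 0 ≤ θW ∧ θW < 1 ∧ 0 < δW ∧
      (∀ j, VertexFamily₂ (unitW (sfStep Lc j) (smStep 3 Lc j) (WbalOf 3 Lc cE cVH cΛ (T2Of 3 Lc cE cVH cΛ ((Lc : ℝ) ^ (2 * (3 + 1))) cB Tc (vh₂SAt (toSite r) Lc) (mixFFAt (toSite r) Lc)) (mixFFAt (toSite r) Lc) j)) Lc Cw δW) ∧
      (∀ k j, VertexFamily₂ (unitW (sfStep Lc (k + j)) (smStep 3 Lc (k + j)) (WbalOf 3 Lc cE cVH cΛ (T2Of 3 Lc cE cVH cΛ ((Lc : ℝ) ^ (2 * (3 + 1))) cB Tc (vh₂SAt (toSite r) Lc) (mixFFAt (toSite r) Lc)) (mixFFAt (toSite r) Lc) (k + j)) -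
        unitW (sfStep Lc k) (smStep 3 Lc k) (WbalOf 3 Lc cE cVH cΛ (T2Of 3 Lc cE cVH cΛ ((Lc : ℝ) ^ (2 * (3 + 1))) cB Tc (vh₂SAt (toSite r) Lc) (mixFFAt (toSite r) Lc)) (mixFFAt (toSite r) Lc) k)) Lc (cW * θW ^ k) δW) :=
  hW_hWall_three_an1At_of_pinEq hLc hr cE cVH cΛ _ cB Tc rfl

/-! ## §3 THE CLOSING SENTENCE for `JsBalAn1` / `JsBalAn1Ctr`: the D1 wall ⟺ the identification, no analytic hypothesis -/

/-- **BINDER ROW G-an2-4 AT `d = 3`, CLOSING SENTENCE FOR THE PINNED FAMILY AT an1's ROOTED TABLES: THE D1 WALL ⟺ THE IDENTIFICATION, UNCONDITIONALLY** — the owner's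
generic-`W` wall form `StencilSlotWallThree.d1Drift_JsBalOf_iff_three_of_wRows` (K-slot + road S3's twelve rows inside, border-free) fed with §2.  [folklore] composition. -/
theorem d1Drift_iff_three_an1At_pinned (hLc : 2 ≤ Lc) (hr : r ∈ box (3 + 1) Lc) (cE cVH cΛ cB : ℝ)
    (Tc : Fin 4 → Fin 4 → Fin 4 → Fin 4 → ℝ) (μ ν : Fin 4) (N : ℝ) :
    D1Drift Lc (JsBalOf (one_le_of_two_le hLc) cE cVH cΛ (WbalOf 3 Lc cE cVH cΛ (T2Of 3 Lc cE cVH cΛ ((Lc : ℝ) ^ (2 * (3 + 1))) cB Tc (vh₂SAt (toSite r) Lc) (mixFFAt (toSite r) Lc)) (mixFFAt (toSite r) Lc))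
        (CwOf (one_le_of_two_le hLc) cE cVH cΛ (T2Of_loc (one_le_of_two_le hLc) cE cVH cΛ ((Lc : ℝ) ^ (2 * (3 + 1))) cB Tc (hB_an1 (one_le_of_two_le hLc) hr) (hmix_an1 (one_le_of_two_le hLc) hr)) (hmix_an1 (one_le_of_two_le hLc) hr)) (δwOf (one_le_of_two_le hLc) cE cVH cΛ (T2Of_loc (one_le_of_two_le hLc) cE cVH cΛ ((Lc : ℝ) ^ (2 * (3 + 1))) cB Tc (hB_an1 (one_le_of_two_le hLc) hr) (hmix_an1 (one_le_of_two_le hLc) hr)) (hmix_an1 (one_le_of_two_le hLc) hr))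
        (δwOf_pos (one_le_of_two_le hLc) cE cVH cΛ (T2Of_loc (one_le_of_two_le hLc) cE cVH cΛ ((Lc : ℝ) ^ (2 * (3 + 1))) cB Tc (hB_an1 (one_le_of_two_le hLc) hr) (hmix_an1 (one_le_of_two_le hLc) hr)) (hmix_an1 (one_le_of_two_le hLc) hr)) (WbalOf_loc₂ (one_le_of_two_le hLc) cE cVH cΛ (T2Of_loc (one_le_of_two_le hLc) cE cVH cΛ ((Lc : ℝ) ^ (2 * (3 + 1))) cB Tc (hB_an1 (one_le_of_two_le hLc) hr) (hmix_an1 (one_le_of_two_le hLc) hr)) (hmix_an1 (one_le_of_two_le hLc) hr))) N μ ν ↔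
      B12Beta.secondMoment (hessKer (axDressK Lc (limMKerOf fun j => unitK (sfStep Lc j) (smStep 3 Lc j) (KInvStep (d := 3) Lc j)))
        (axVertexOfK (limMKerOf fun j => unitK (sfStep Lc j) (smStep 3 Lc j) (KInvStep (d := 3) Lc j)) Lc
          (limStOf fun j => unitS (sfStep Lc j) (smStep 3 Lc j) (JsBal0Of (one_le_of_two_le hLc) cE cVH cΛ (WbalOf 3 Lc cE cVH cΛ (T2Of 3 Lc cE cVH cΛ ((Lc : ℝ) ^ (2 * (3 + 1))) cB Tc (vh₂SAt (toSite r) Lc) (mixFFAt (toSite r) Lc)) (mixFFAt (toSite r) Lc))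
            (CwOf (one_le_of_two_le hLc) cE cVH cΛ (T2Of_loc (one_le_of_two_le hLc) cE cVH cΛ ((Lc : ℝ) ^ (2 * (3 + 1))) cB Tc (hB_an1 (one_le_of_two_le hLc) hr) (hmix_an1 (one_le_of_two_le hLc) hr)) (hmix_an1 (one_le_of_two_le hLc) hr)) (δwOf (one_le_of_two_le hLc) cE cVH cΛ (T2Of_loc (one_le_of_two_le hLc) cE cVH cΛ ((Lc : ℝ) ^ (2 * (3 + 1))) cB Tc (hB_an1 (one_le_of_two_le hLc) hr) (hmix_an1 (one_le_of_two_le hLc) hr)) (hmix_an1 (one_le_of_two_le hLc) hr))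
        (δwOf_pos (one_le_of_two_le hLc) cE cVH cΛ (T2Of_loc (one_le_of_two_le hLc) cE cVH cΛ ((Lc : ℝ) ^ (2 * (3 + 1))) cB Tc (hB_an1 (one_le_of_two_le hLc) hr) (hmix_an1 (one_le_of_two_le hLc) hr)) (hmix_an1 (one_le_of_two_le hLc) hr)) (WbalOf_loc₂ (one_le_of_two_le hLc) cE cVH cΛ (T2Of_loc (one_le_of_two_le hLc) cE cVH cΛ ((Lc : ℝ) ^ (2 * (3 + 1))) cB Tc (hB_an1 (one_le_of_two_le hLc) hr) (hmix_an1 (one_le_of_two_le hLc) hr)) (hmix_an1 (one_le_of_two_le hLc) hr)) j).S))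
        (limTabOf fun j => unitW (sfStep Lc j) (smStep 3 Lc j) (WbalOf 3 Lc cE cVH cΛ (T2Of 3 Lc cE cVH cΛ ((Lc : ℝ) ^ (2 * (3 + 1))) cB Tc (vh₂SAt (toSite r) Lc) (mixFFAt (toSite r) Lc)) (mixFFAt (toSite r) Lc) j))) μ ν = B12Normalization.stepBal N Lc := by
  obtain ⟨Cw, cW, θW, δW, hθW0, hθW1, hδW, hW₂, hW₂all⟩ := hW_hWall_three_an1At_pinned hLc hr cE cVH cΛ cB Tc
  exact d1Drift_JsBalOf_iff_three_of_wRows hLc cE cVH cΛ _ _ _ _ _ hW₂ hW₂all hδW hθW0 hθW1 μ ν N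

/-- **THE SAME CLOSING SENTENCE FOR THE β-LEAD's LITERAL `MixedJetTablesPlug.JsBalAn1 hLc hr cE cVH cΛ cE₂ cB Tc` AT `cE₂ := (Lc:ℝ)^(2*(3+1))`** (`JsBalAn1 := JsBalT2Of … (hB_an1 …)
(hmix_an1 …)`, definitionally §3's family): the D1 wall ⟺ the identification, NO analytic hypothesis — given only `2 ≤ Lc`, `r ∈ box (3+1) Lc`. -/
theorem d1Drift_iff_three_JsBalAn1_pinned (hLc : 2 ≤ Lc) (hr : r ∈ box (3 + 1) Lc) (cE cVH cΛ cB : ℝ)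
    (Tc : Fin 4 → Fin 4 → Fin 4 → Fin 4 → ℝ) (μ ν : Fin 4) (N : ℝ) :
    D1Drift Lc (JsBalAn1 (one_le_of_two_le hLc) hr cE cVH cΛ ((Lc : ℝ) ^ (2 * (3 + 1))) cB Tc) N μ ν ↔
      B12Beta.secondMoment (hessKer (axDressK Lc (limMKerOf fun j => unitK (sfStep Lc j) (smStep 3 Lc j) (KInvStep (d := 3) Lc j)))
        (axVertexOfK (limMKerOf fun j => unitK (sfStep Lc j) (smStep 3 Lc j) (KInvStep (d := 3) Lc j)) Lc
          (limStOf fun j => unitS (sfStep Lc j) (smStep 3 Lc j) (JsBal0Of (one_le_of_two_le hLc) cE cVH cΛ (WbalOf 3 Lc cE cVH cΛ (T2Of 3 Lc cE cVH cΛ ((Lc : ℝ) ^ (2 * (3 + 1))) cB Tc (vh₂SAt (toSite r) Lc) (mixFFAt (toSite r) Lc)) (mixFFAt (toSite r) Lc))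
            (CwOf (one_le_of_two_le hLc) cE cVH cΛ (T2Of_loc (one_le_of_two_le hLc) cE cVH cΛ ((Lc : ℝ) ^ (2 * (3 + 1))) cB Tc (hB_an1 (one_le_of_two_le hLc) hr) (hmix_an1 (one_le_of_two_le hLc) hr)) (hmix_an1 (one_le_of_two_le hLc) hr)) (δwOf (one_le_of_two_le hLc) cE cVH cΛ (T2Of_loc (one_le_of_two_le hLc) cE cVH cΛ ((Lc : ℝ) ^ (2 * (3 + 1))) cB Tc (hB_an1 (one_le_of_two_le hLc) hr) (hmix_an1 (one_le_of_two_le hLc) hr)) (hmix_an1 (one_le_of_two_le hLc) hr))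
        (δwOf_pos (one_le_of_two_le hLc) cE cVH cΛ (T2Of_loc (one_le_of_two_le hLc) cE cVH cΛ ((Lc : ℝ) ^ (2 * (3 + 1))) cB Tc (hB_an1 (one_le_of_two_le hLc) hr) (hmix_an1 (one_le_of_two_le hLc) hr)) (hmix_an1 (one_le_of_two_le hLc) hr)) (WbalOf_loc₂ (one_le_of_two_le hLc) cE cVH cΛ (T2Of_loc (one_le_of_two_le hLc) cE cVH cΛ ((Lc : ℝ) ^ (2 * (3 + 1))) cB Tc (hB_an1 (one_le_of_two_le hLc) hr) (hmix_an1 (one_le_of_two_le hLc) hr)) (hmix_an1 (one_le_of_two_le hLc) hr)) j).S))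
        (limTabOf fun j => unitW (sfStep Lc j) (smStep 3 Lc j) (WbalOf 3 Lc cE cVH cΛ (T2Of 3 Lc cE cVH cΛ ((Lc : ℝ) ^ (2 * (3 + 1))) cB Tc (vh₂SAt (toSite r) Lc) (mixFFAt (toSite r) Lc)) (mixFFAt (toSite r) Lc) j))) μ ν = B12Normalization.stepBal N Lc :=
  d1Drift_iff_three_an1At_pinned hLc hr cE cVH cΛ cB Tc μ ν N

/-- **THE CLOSING SENTENCE AT THE CENTRED ROOT — road BF-x's literal `MixedJetTablesPlug.JsBalAn1Ctr`** (`= JsBalAn1 … (ctrOff_mem_box …)` by `rfl`) AT `cE₂ := (Lc:ℝ)^(2*(3+1))`: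
`D1Drift Lc (JsBalAn1Ctr …) N μ ν ⟺` the identification at the centred tables, NO analytic hypothesis, every `Lc ≥ 2`. -/
theorem d1Drift_iff_three_JsBalAn1Ctr_pinned (hLc : 2 ≤ Lc) (cE cVH cΛ cB : ℝ)
    (Tc : Fin 4 → Fin 4 → Fin 4 → Fin 4 → ℝ) (μ ν : Fin 4) (N : ℝ) :
    D1Drift Lc (JsBalAn1Ctr (one_le_of_two_le hLc) cE cVH cΛ ((Lc : ℝ) ^ (2 * (3 + 1))) cB Tc) N μ ν ↔
      B12Beta.secondMoment (hessKer (axDressK Lc (limMKerOf fun j => unitK (sfStep Lc j) (smStep 3 Lc j) (KInvStep (d := 3) Lc j)))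
        (axVertexOfK (limMKerOf fun j => unitK (sfStep Lc j) (smStep 3 Lc j) (KInvStep (d := 3) Lc j)) Lc
          (limStOf fun j => unitS (sfStep Lc j) (smStep 3 Lc j) (JsBal0Of (one_le_of_two_le hLc) cE cVH cΛ (WbalOf 3 Lc cE cVH cΛ (T2Of 3 Lc cE cVH cΛ ((Lc : ℝ) ^ (2 * (3 + 1))) cB Tc (vh₂SAt (toSite (ctrOff (3 + 1) Lc)) Lc) (mixFFAt (toSite (ctrOff (3 + 1) Lc)) Lc)) (mixFFAt (toSite (ctrOff (3 + 1) Lc)) Lc))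
            (CwOf (one_le_of_two_le hLc) cE cVH cΛ (T2Of_loc (one_le_of_two_le hLc) cE cVH cΛ ((Lc : ℝ) ^ (2 * (3 + 1))) cB Tc (hB_an1 (one_le_of_two_le hLc) (ctrOff_mem_box (one_le_of_two_le hLc))) (hmix_an1 (one_le_of_two_le hLc) (ctrOff_mem_box (one_le_of_two_le hLc)))) (hmix_an1 (one_le_of_two_le hLc) (ctrOff_mem_box (one_le_of_two_le hLc)))) (δwOf (one_le_of_two_le hLc) cE cVH cΛ (T2Of_loc (one_le_of_two_le hLc) cE cVH cΛ ((Lc : ℝ) ^ (2 * (3 + 1))) cB Tc (hB_an1 (one_le_of_two_le hLc) (ctrOff_mem_box (one_le_of_two_le hLc))) (hmix_an1 (one_le_of_two_le hLc) (ctrOff_mem_box (one_le_of_two_le hLc)))) (hmix_an1 (one_le_of_two_le hLc) (ctrOff_mem_box (one_le_of_two_le hLc))))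
        (δwOf_pos (one_le_of_two_le hLc) cE cVH cΛ (T2Of_loc (one_le_of_two_le hLc) cE cVH cΛ ((Lc : ℝ) ^ (2 * (3 + 1))) cB Tc (hB_an1 (one_le_of_two_le hLc) (ctrOff_mem_box (one_le_of_two_le hLc))) (hmix_an1 (one_le_of_two_le hLc) (ctrOff_mem_box (one_le_of_two_le hLc)))) (hmix_an1 (one_le_of_two_le hLc) (ctrOff_mem_box (one_le_of_two_le hLc)))) (WbalOf_loc₂ (one_le_of_two_le hLc) cE cVH cΛ (T2Of_loc (one_le_of_two_le hLc) cE cVH cΛ ((Lc : ℝ) ^ (2 * (3 + 1))) cB Tc (hB_an1 (one_le_of_two_le hLc) (ctrOff_mem_box (one_le_of_two_le hLc))) (hmix_an1 (one_le_of_two_le hLc) (ctrOff_mem_box (one_le_of_two_le hLc)))) (hmix_an1 (one_le_of_two_le hLc) (ctrOff_mem_box (one_le_of_two_le hLc)))) j).S))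
        (limTabOf fun j => unitW (sfStep Lc j) (smStep 3 Lc j) (WbalOf 3 Lc cE cVH cΛ (T2Of 3 Lc cE cVH cΛ ((Lc : ℝ) ^ (2 * (3 + 1))) cB Tc (vh₂SAt (toSite (ctrOff (3 + 1) Lc)) Lc) (mixFFAt (toSite (ctrOff (3 + 1) Lc)) Lc)) (mixFFAt (toSite (ctrOff (3 + 1) Lc)) Lc) j))) μ ν = B12Normalization.stepBal N Lc :=
  d1Drift_iff_three_JsBalAn1_pinned hLc (ctrOff_mem_box (one_le_of_two_le hLc)) cE cVH cΛ cB Tc μ ν N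


/-! ## §4 Road BF-x's `hall` binder: the ALL-SCALES bound of the step coefficients of `JsBalAn1` / `JsBalAn1Ctr` at the exact pin, no hypothesis -/

/-- **THE ALL-SCALES BOUND OF THE ONE-LOOP STEP COEFFICIENTS OF THE β-LEAD's LITERAL `JsBalAn1` AT THE EXACT PIN** — the `hall` ∕ `hθ0` ∕ `hθ1` binders of road
BF-x's `D1BFx/RoadEnd.d1Drift_of_meanRoad` ∕ `d1Drift_iff_cesaro` for THIS family, with NO hypothesis beyond `2 ≤ Lc`, `r ∈ box (3+1) Lc`: K-slot `KSlotAssembly.convCKWall_holds`,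
S-slot `StencilSlotSAllThree.hS_hSall_three`, W-slot §2, rates ∕ window merged by asym1's `HessKerConvCKPlug.exists_merged_rows`, then asym1's
`HessKerDressedUnitsWall.allScalesSeq_secondMoment_TbalOf_JsBalOf_unit` (explicit `κ`, hidden in the `∃`).  [folklore] composition. -/
theorem allScalesSeq_secondMoment_JsBalAn1_pinned (hLc : 2 ≤ Lc) (hr : r ∈ box (3 + 1) Lc) (cE cVH cΛ cB : ℝ)
    (Tc : Fin 4 → Fin 4 → Fin 4 → Fin 4 → ℝ) (μ ν : Fin 4) :
    ∃ κ θ : ℝ, 0 ≤ θ ∧ θ < 1 ∧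
      AllScalesSeq (fun j => B12Beta.secondMoment
        (TbalOf Lc (JsBalAn1 (one_le_of_two_le hLc) hr cE cVH cΛ ((Lc : ℝ) ^ (2 * (3 + 1))) cB Tc) j) μ ν) κ θ := by
  obtain ⟨Cw, cW, θW, δW, hθW0, hθW1, hδW, hW₂, hW₂all⟩ := hW_hWall_three_an1At_pinned hLc hr cE cVH cΛ cB Tc
  obtain ⟨Cs, cS, θS, δS, hθS0, hθS1, hδS, hS, hSall⟩ := hS_hSall_three hLc cE cVH cΛ
    (WbalOf 3 Lc cE cVH cΛ (T2Of 3 Lc cE cVH cΛ ((Lc : ℝ) ^ (2 * (3 + 1))) cB Tc (vh₂SAt (toSite r) Lc) (mixFFAt (toSite r) Lc)) (mixFFAt (toSite r) Lc)) _ _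
    (δwOf_pos (one_le_of_two_le hLc) cE cVH cΛ (T2Of_loc (one_le_of_two_le hLc) cE cVH cΛ ((Lc : ℝ) ^ (2 * (3 + 1))) cB Tc
        (hB_an1 (one_le_of_two_le hLc) hr) (hmix_an1 (one_le_of_two_le hLc) hr)) (hmix_an1 (one_le_of_two_le hLc) hr))
    (WbalOf_loc₂ (one_le_of_two_le hLc) cE cVH cΛ (T2Of_loc (one_le_of_two_le hLc) cE cVH cΛ ((Lc : ℝ) ^ (2 * (3 + 1))) cB Tc
        (hB_an1 (one_le_of_two_le hLc) hr) (hmix_an1 (one_le_of_two_le hLc) hr)) (hmix_an1 (one_le_of_two_le hLc) hr))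
  obtain ⟨C, δK, cK, θ, R, hR, hRK, hRS, hRW, hθ0, hθ1, hK, hKall, hSall', hWall'⟩ :=
    exists_merged_rows (Lc := Lc) (convCKWall_holds (Lc := Lc) hLc)
      (S := fun j => unitS (sfStep Lc j) (smStep 3 Lc j) (JsBal0Of (one_le_of_two_le hLc) cE cVH cΛ (WbalOf 3 Lc cE cVH cΛ (T2Of 3 Lc cE cVH cΛ ((Lc : ℝ) ^ (2 * (3 + 1))) cB Tc (vh₂SAt (toSite r) Lc) (mixFFAt (toSite r) Lc)) (mixFFAt (toSite r) Lc))
        (CwOf (one_le_of_two_le hLc) cE cVH cΛ (T2Of_loc (one_le_of_two_le hLc) cE cVH cΛ ((Lc : ℝ) ^ (2 * (3 + 1))) cB Tc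
        (hB_an1 (one_le_of_two_le hLc) hr) (hmix_an1 (one_le_of_two_le hLc) hr)) (hmix_an1 (one_le_of_two_le hLc) hr))
        (δwOf (one_le_of_two_le hLc) cE cVH cΛ (T2Of_loc (one_le_of_two_le hLc) cE cVH cΛ ((Lc : ℝ) ^ (2 * (3 + 1))) cB Tc
        (hB_an1 (one_le_of_two_le hLc) hr) (hmix_an1 (one_le_of_two_le hLc) hr)) (hmix_an1 (one_le_of_two_le hLc) hr))
        (δwOf_pos (one_le_of_two_le hLc) cE cVH cΛ (T2Of_loc (one_le_of_two_le hLc) cE cVH cΛ ((Lc : ℝ) ^ (2 * (3 + 1))) cB Tc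
        (hB_an1 (one_le_of_two_le hLc) hr) (hmix_an1 (one_le_of_two_le hLc) hr)) (hmix_an1 (one_le_of_two_le hLc) hr))
        (WbalOf_loc₂ (one_le_of_two_le hLc) cE cVH cΛ (T2Of_loc (one_le_of_two_le hLc) cE cVH cΛ ((Lc : ℝ) ^ (2 * (3 + 1))) cB Tc
        (hB_an1 (one_le_of_two_le hLc) hr) (hmix_an1 (one_le_of_two_le hLc) hr)) (hmix_an1 (one_le_of_two_le hLc) hr)) j).S)
      (W := fun j => unitW (sfStep Lc j) (smStep 3 Lc j) ((WbalOf 3 Lc cE cVH cΛ (T2Of 3 Lc cE cVH cΛ ((Lc : ℝ) ^ (2 * (3 + 1))) cB Tc (vh₂SAt (toSite r) Lc) (mixFFAt (toSite r) Lc)) (mixFFAt (toSite r) Lc)) j))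
      hSall hW₂all hδS hδW hθS0 hθS1 hθW0 hθW1
  exact ⟨_, θ, hθ0, hθ1, allScalesSeq_secondMoment_TbalOf_JsBalOf_unit (one_le_of_two_le hLc) cE cVH cΛ _ _ _ _ _
    (sfStep Lc) (smStep 3 Lc) sfStep_ne_zero smStep_ne_zero hK hKall hS hSall' hW₂ hWall' hR (by linarith) hRS hRW μ ν⟩

/-- **THE SAME AT THE CENTRED ROOT — road BF-x's literal `JsBalAn1Ctr`** (every `Lc ≥ 2`, every channel): `∃ κ θ, 0 ≤ θ < 1 ∧ AllScalesSeq (j ↦ β⁰_j) κ θ`. -/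
theorem allScalesSeq_secondMoment_JsBalAn1Ctr_pinned (hLc : 2 ≤ Lc) (cE cVH cΛ cB : ℝ) (Tc : Fin 4 → Fin 4 → Fin 4 → Fin 4 → ℝ) (μ ν : Fin 4) :
    ∃ κ θ : ℝ, 0 ≤ θ ∧ θ < 1 ∧
      AllScalesSeq (fun j => B12Beta.secondMoment
        (TbalOf Lc (JsBalAn1Ctr (one_le_of_two_le hLc) cE cVH cΛ ((Lc : ℝ) ^ (2 * (3 + 1))) cB Tc) j) μ ν) κ θ :=
  allScalesSeq_secondMoment_JsBalAn1_pinned hLc (ctrOff_mem_box (one_le_of_two_le hLc)) cE cVH cΛ cB Tc μ ν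

end Summit.QuantumFields.BalabanUV.Beta.GAN24.WSlotT2TablesAn1

end
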